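import Mathlib
import HarnessLib
import Summits.HubbardSuperconductivity.HubbardSuperconductivity.Theorems.KLProgrammeKLRegimeEnginePairTransferOutClassAssemblyG13
import Summits.HubbardSuperconductivity.HubbardSuperconductivity.Theorems.KLProgrammeKLRegimeEngineV8DefsG14

/-!
# Route `KLProgramme` — ENGINE item stmt-HubbardSuperconductivity-20437 `KLRegimeEngineV17F2`, stub (c) value lane, «(c)-OUT» ASSEMBLY ROBUST TO AMENDMENTS 24/25:
# the out-of-class (E2″-F)ₙ₊₁ bracket at `klEngGeo14` in SHARE form with an ABSTRACT erem host (cell gate-hubbard-kl, seat hubbard-kl-k3c2-p2 g21)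

`…OutClassAssemblyG13` (g19) assembles the three steps of the out-of-class increment — frame shift `‖a − b‖ ≤ frameShiftBar`, same-shell flow (i)
`‖b − c‖ ≤ gainBar G11 + E₁ + thermalBar G11`, un-smearing (iii) `‖c − d‖ ≤ Tb + Neumann` — with the class-#5 bar booked as ONE in-class step
`Tb ≤ gainBar G11 + E₂ + thermalBar G11` and the erem shares `E₁ + E₂ ≤ eremBar G11 … n`.  Under AMENDMENT 25 «(X).3-KLTS-CAP + FLAT-CUBIC» ((R257)/(R260)(2))
the bar's prefactor runs over the `klTS`-keyed cap `0 ≤ r ≤ 2²⁰(1+klTS)` (opaque `klTS`), so `Tb` no longer books at `klEngGeo11`: it books in SHARE form against the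
`klTS`-keyed host `klEngGeo14 := (klEngGeo13.addShellLog (2⁵²klTS)).raiseCF (2⁸⁰klTS)` (`transferBarRelIdx_le_slots_klEngGeo14_of_cap`, p1's
`transferBarRelIdx3_le_slots_klEngGeo14_of_cap`): `Tb ≤ 2⁻¹⁵(KlamU)²(G14.phGain ρd + G14.phGain ρx) + E₂ + 2⁻⁵·thermalBar G14`, and its residue `E₂` carries the flat cubic
`2r·15367·c₃·(Klam|U|)³`, whose erem host is the pen's open text choice.  This file makes the assembly independent of both choices:
* §1 `outClass_hout_le_bars_klEngGeo13_host` — the g19 assembly with the erem slot an ABSTRACT real `Ē ≥ E₁ + E₂` (= `eremBar` today, = the re-profiled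
  bar or `eremBar + Q.CR·c₃·(Klam|U|)³` under door (ii));
* §2 **`outClass_hout_le_bars_klEngGeo14_of_shares`** — token `klEngGeo14`, `Tb` in share form: the `klTS`-part of the ph share sits in `G14 − G13 = 2⁵²klTS·(…)`,
  the rest and step (i) in `G13 = 2·G11 + pp shell-log` (`xsMass_succ_le_gainBar_klEngGeo13`), thermal `thermalBar G11 + 2⁻⁵thermalBar G14 ≤ thermalBar G14`;
  `…_of_cap` = the same fed by `transferBarRelIdx_le_slots_klEngGeo14_of_cap` (bar of record, any `r` under the cap);
* §3 `GeoConsts.SlotLE.outClass_bound_le` — the assembled bracket lifts along any `G ≼ G′` (`…_klEngGeo14_of_klEngGeo13`: the g19/g20 literal `hout` theorems at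
  `klEngGeo13` give `klEngGeo14` by one call);
* §4 the erem SHARE ARITHMETIC with the flat cubic: `relBarE2_flat_le_share` (flat passes through), `relBarE2_flat_le_share_host` (host `a·(eremBar + Q.CR·c₃·K₃)`),
  `hout_hE_of_share(_host)` (the `hE` binder from `2s + a ≤ 1`), and the discharge of both share hypotheses at a `klTS`-KEYED `Q`-floor
  (`relBar_cap_shares_half_of_floor`: `2⁶⁰Psq²Rsq²(1+klTS) ≤ Q.CR`, `…·(β²+1)4ⁿ ≤ Q.CL β n` — the Q-side line of (R257)).
Real arithmetic over landed lemmas; nothing about the model is asserted; nothing asserts (E2″-F), (c), K3 or superconductivity.  0 kit · 0 lit.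
-/

noncomputable section

namespace Summit.HubbardSuperconductivity.HubbardSuperconductivity.Theorems.EngineV8

set_option linter.dupNamespace false -- summit = problem name (single-conjunct summit), D-0017

open Real Finset Literature.MathematicalPhysics.QuantumLattice Literature.Probability.LatticeModels
open Summit.HubbardSuperconductivity.HubbardSuperconductivity.Theorems.KLRegimeSplit
open Summit.HubbardSuperconductivity.HubbardSuperconductivity.Theorems.KLProgrammeLegKernels
open Summit.HubbardSuperconductivity.HubbardSuperconductivity.Theorems.DispersionFlow

/-! ## §1 The `klEngGeo13` assembly with an abstract erem host -/

/-- **«(c)-OUT» at `klEngGeo13`, ABSTRACT EREM HOST**: as `outClass_hout_le_bars_klEngGeo13` with `E₁ + E₂ ≤ Ē` for any real `Ē` in the erem slot. -/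
theorem outClass_hout_le_bars_klEngGeo13_host {P : SplitConsts} {Q : EngConsts} {U β : ℝ} {n : ℕ} {ρpp ρd ρx : ℝ} (hρ : 0 ≤ ρpp)
    {a b c d : ℂ} {E₁ E₂ Tb D Ebar : ℝ}
    (hshift : ‖a - b‖ ≤ frameShiftBar P Q U (n + 1))
    (h₁ : ‖b - c‖ ≤ gainBar klEngGeo11 P U (n + 1) ρpp ρd ρx + E₁ + thermalBar klEngGeo11 P U β (n + 1))
    (h₃ : ‖c - d‖ ≤ Tb + (P.Klam * U) ^ 2 * ((2 ^ 17 * klTS + 2 ^ 27) * (klRelGain n ρpp + ((2 : ℝ) ^ n)⁻¹)))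
    (hTb : Tb ≤ gainBar klEngGeo11 P U (n + 1) ρpp ρd ρx + E₂ + thermalBar klEngGeo11 P U β (n + 1))
    (hE : E₁ + E₂ ≤ Ebar) (hD : 0 ≤ D) :
    ‖a - d‖ ≤ gainBar klEngGeo13 P U (n + 1) ρpp ρd ρx + Ebar + thermalBar klEngGeo13 P U β (n + 1) + D + frameShiftBar P Q U (n + 1) := by
  have htri : ‖a - d‖ ≤ ‖a - b‖ + ‖b - c‖ + ‖c - d‖ := by
    have h1 := norm_sub_le_norm_sub_add_norm_sub a b d
    have h2 := norm_sub_le_norm_sub_add_norm_sub b c d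
    linarith
  have hx := xsMass_succ_le_gainBar_klEngGeo13 P U n hρ ρd ρx
  have hth := two_mul_thermalBar_klEngGeo11_le_klEngGeo13 P U β (n + 1)
  linarith

/-! ## §2 The `klEngGeo14` assembly with `Tb` in SHARE form (AMENDMENT 25 shape (a)) -/

/-- `gainBar klEngGeo14 = gainBar klEngGeo13 + (KlamU)²·2⁵²klTS·((klRelGain (ρd⊔0) + 2⁻ᴺ) + (klRelGain (ρx⊔0) + 2⁻ᴺ))`. -/
theorem gainBar_klEngGeo14_eq (P : SplitConsts) (U : ℝ) (N : ℕ) (ρpp ρd ρx : ℝ) :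
    gainBar klEngGeo14 P U N ρpp ρd ρx = gainBar klEngGeo13 P U N ρpp ρd ρx +
      (P.Klam * U) ^ 2 * (2 ^ 52 * klTS * ((klRelGain N (max ρd 0) + ((2 : ℝ) ^ N)⁻¹) + (klRelGain N (max ρx 0) + ((2 : ℝ) ^ N)⁻¹))) := by
  unfold gainBar
  rw [klEngGeo14_ppGain, klEngGeo14_phGain, klEngGeo14_phGain]
  ring

/-- **THE ph SHARE OF THE CAPPED BAR FITS**: for `0 ≤ ρpp, ρd, ρx`,
`gainBar G11 + 2⁻¹⁵(KlamU)²(G14.phGain ρd + G14.phGain ρx) + Neumann ≤ gainBar G14` (all at the step's index `n+1`, Neumann term at `n`). -/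
theorem gainBar_klEngGeo11_add_phShare_add_xs_le_klEngGeo14 (P : SplitConsts) (U : ℝ) (n : ℕ) {ρpp ρd ρx : ℝ} (hρ : 0 ≤ ρpp) (hρd : 0 ≤ ρd) (hρx : 0 ≤ ρx) :
    gainBar klEngGeo11 P U (n + 1) ρpp ρd ρx +
        (2 : ℝ)⁻¹ ^ 15 * ((P.Klam * U) ^ 2 * (klEngGeo14.phGain (n + 1) ρd + klEngGeo14.phGain (n + 1) ρx)) +
          (P.Klam * U) ^ 2 * ((2 ^ 17 * klTS + 2 ^ 27) * (klRelGain n ρpp + ((2 : ℝ) ^ n)⁻¹)) ≤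
      gainBar klEngGeo14 P U (n + 1) ρpp ρd ρx := by
  have hx := xsMass_succ_le_gainBar_klEngGeo13 P U n hρ ρd ρx
  rw [gainBar_klEngGeo14_eq, max_eq_left hρd, max_eq_left hρx, klEngGeo14_phGain, klEngGeo14_phGain, max_eq_left hρd, max_eq_left hρx,
    klEngGeo13_phGain, klEngGeo13_phGain]
  have hK : 0 ≤ (P.Klam * U) ^ 2 := sq_nonneg _
  have hT := klTS_nonneg
  have hgd : 0 ≤ klRelGain (n + 1) ρd + ((2 : ℝ) ^ (n + 1))⁻¹ := by have := klRelGain_nonneg (n + 1) hρd; positivity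
  have hgx : 0 ≤ klRelGain (n + 1) ρx + ((2 : ℝ) ^ (n + 1))⁻¹ := by have := klRelGain_nonneg (n + 1) hρx; positivity
  have hpd := klEngGeo11_phGain_nonneg (n + 1) ρd
  have hpx := klEngGeo11_phGain_nonneg (n + 1) ρx
  have hpp := klEngGeo11_ppGain_nonneg (n + 1) ρpp
  -- the non-`klTS` part of the share sits in the spare copy of `gainBar G11`, the `klTS` part in `G14 − G13`
  have hG11 : gainBar klEngGeo11 P U (n + 1) ρpp ρd ρx = (P.Klam * U) ^ 2 * (klEngGeo11.ppGain (n + 1) ρpp + klEngGeo11.phGain (n + 1) ρd + klEngGeo11.phGain (n + 1) ρx) := rfl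
  have h1 : (2 : ℝ)⁻¹ ^ 15 * ((P.Klam * U) ^ 2 * (2 * klEngGeo11.phGain (n + 1) ρd + 2 ^ 52 * klTS * (klRelGain (n + 1) ρd + ((2 : ℝ) ^ (n + 1))⁻¹) +
        (2 * klEngGeo11.phGain (n + 1) ρx + 2 ^ 52 * klTS * (klRelGain (n + 1) ρx + ((2 : ℝ) ^ (n + 1))⁻¹)))) ≤
      gainBar klEngGeo11 P U (n + 1) ρpp ρd ρx +
        (P.Klam * U) ^ 2 * (2 ^ 52 * klTS * ((klRelGain (n + 1) ρd + ((2 : ℝ) ^ (n + 1))⁻¹) + (klRelGain (n + 1) ρx + ((2 : ℝ) ^ (n + 1))⁻¹))) := by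
    rw [hG11]
    have hin : (2 : ℝ)⁻¹ ^ 15 * (2 * klEngGeo11.phGain (n + 1) ρd + 2 ^ 52 * klTS * (klRelGain (n + 1) ρd + ((2 : ℝ) ^ (n + 1))⁻¹) +
          (2 * klEngGeo11.phGain (n + 1) ρx + 2 ^ 52 * klTS * (klRelGain (n + 1) ρx + ((2 : ℝ) ^ (n + 1))⁻¹))) ≤
        (klEngGeo11.ppGain (n + 1) ρpp + klEngGeo11.phGain (n + 1) ρd + klEngGeo11.phGain (n + 1) ρx) +
          2 ^ 52 * klTS * ((klRelGain (n + 1) ρd + ((2 : ℝ) ^ (n + 1))⁻¹) + (klRelGain (n + 1) ρx + ((2 : ℝ) ^ (n + 1))⁻¹)) := by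
      nlinarith
    have := mul_le_mul_of_nonneg_left hin hK
    nlinarith
  nlinarith

/-- **THE THERMAL SHARE FITS**: `thermalBar G11 + 2⁻⁵·thermalBar G14 ≤ thermalBar G14`. -/
theorem thermalBar_klEngGeo11_add_share_le_klEngGeo14 (P : SplitConsts) (U β : ℝ) (N : ℕ) :
    thermalBar klEngGeo11 P U β N + (2 : ℝ)⁻¹ ^ 5 * thermalBar klEngGeo14 P U β N ≤ thermalBar klEngGeo14 P U β N := by
  have h13 := two_mul_thermalBar_klEngGeo11_le_klEngGeo13 P U β N
  have h14 := slotLE_klEngGeo13_klEngGeo14.thermalBar_mono P U β N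
  have h0 : 0 ≤ thermalBar klEngGeo11 P U β N := thermalBar_nonneg klEngGeo11_CF_nonneg P U β N
  nlinarith

/-- **«(c)-OUT» ASSEMBLED AT `klEngGeo14`, `Tb` IN SHARE FORM, ABSTRACT EREM HOST** (module docstring): `a = 𝒞ₙ₊₁[Kₙ₊₁]`, `b = 𝒞ₙ₊₁[Kₙ]`, `c = A°ₙ[s_{n,n+1}]`,
`d = 𝒞ₙ[Kₙ]`; frame shift, step (i) at `klEngGeo11` with residue `E₁`, step (iii) = `Tb` + Neumann term, `Tb` booked at the shares `2⁻¹⁵` (ph, against `klEngGeo14`) /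
`2⁻⁵` (thermal) with residue `E₂`, `E₁ + E₂ ≤ Ē`, any `D ≥ 0` (`0 ≤ ρpp, ρd, ρx`) ⇒
`‖a − d‖ ≤ gainBar klEngGeo14 (n+1) ρpp ρd ρx + Ē + thermalBar klEngGeo14 (n+1) + D + frameShiftBar (n+1)`. -/
theorem outClass_hout_le_bars_klEngGeo14_of_shares {P : SplitConsts} {Q : EngConsts} {U β : ℝ} {n : ℕ} {ρpp ρd ρx : ℝ}
    (hρ : 0 ≤ ρpp) (hρd : 0 ≤ ρd) (hρx : 0 ≤ ρx) {a b c d : ℂ} {E₁ E₂ Tb D Ebar : ℝ}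
    (hshift : ‖a - b‖ ≤ frameShiftBar P Q U (n + 1))
    (h₁ : ‖b - c‖ ≤ gainBar klEngGeo11 P U (n + 1) ρpp ρd ρx + E₁ + thermalBar klEngGeo11 P U β (n + 1))
    (h₃ : ‖c - d‖ ≤ Tb + (P.Klam * U) ^ 2 * ((2 ^ 17 * klTS + 2 ^ 27) * (klRelGain n ρpp + ((2 : ℝ) ^ n)⁻¹)))
    (hTb : Tb ≤ (2 : ℝ)⁻¹ ^ 15 * ((P.Klam * U) ^ 2 * (klEngGeo14.phGain (n + 1) ρd + klEngGeo14.phGain (n + 1) ρx)) + E₂ +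
      (2 : ℝ)⁻¹ ^ 5 * thermalBar klEngGeo14 P U β (n + 1))
    (hE : E₁ + E₂ ≤ Ebar) (hD : 0 ≤ D) :
    ‖a - d‖ ≤ gainBar klEngGeo14 P U (n + 1) ρpp ρd ρx + Ebar + thermalBar klEngGeo14 P U β (n + 1) + D + frameShiftBar P Q U (n + 1) := by
  have htri : ‖a - d‖ ≤ ‖a - b‖ + ‖b - c‖ + ‖c - d‖ := by
    have h1 := norm_sub_le_norm_sub_add_norm_sub a b d
    have h2 := norm_sub_le_norm_sub_add_norm_sub b c d
    linarith
  have hg := gainBar_klEngGeo11_add_phShare_add_xs_le_klEngGeo14 P U n hρ hρd hρx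
  have hth := thermalBar_klEngGeo11_add_share_le_klEngGeo14 P U β (n + 1)
  linarith

variable {L : ℕ}

/-- **The same fed by the bar of record under the cap** (`transferBarRelIdx_le_slots_klEngGeo14_of_cap`, …V8DefsG14): for `0 ≤ r ≤ 2²⁰(1+klTS)`, `0 ≤ P.Klam`,
`Tb := transferBarRelIdx L klEngGeoTh P r β U n n Qm k k′`, the residue is `E₂ = 2r·15367(KlamU)²/L + 4r·15367(Klam|U|)³2^{−(n+1)}` and any `Ē ≥ E₁ + E₂` hosts. -/
theorem outClass_hout_le_bars_klEngGeo14_of_cap {P : SplitConsts} (hKl : 0 ≤ P.Klam) {Q : EngConsts} {U β r : ℝ} (hr : 0 ≤ r)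
    (hrc : r ≤ 2 ^ 20 * (1 + klTS)) {n : ℕ} (Qm k k' : TorusSite 2 L) {a b c d : ℂ} {E₁ D Ebar : ℝ}
    (hshift : ‖a - b‖ ≤ frameShiftBar P Q U (n + 1))
    (h₁ : ‖b - c‖ ≤ gainBar klEngGeo11 P U (n + 1) (klTorusNorm L Qm) (klTorusNorm L (k - k')) (klTorusNorm L (k + k' - Qm)) + E₁ +
      thermalBar klEngGeo11 P U β (n + 1))
    (h₃ : ‖c - d‖ ≤ transferBarRelIdx L klEngGeoTh P r β U n n Qm k k' +
      (P.Klam * U) ^ 2 * ((2 ^ 17 * klTS + 2 ^ 27) * (klRelGain n (klTorusNorm L Qm) + ((2 : ℝ) ^ n)⁻¹)))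
    (hE : E₁ + (2 * r * 15367 * ((P.Klam * U) ^ 2 * ((L : ℝ))⁻¹) + 4 * r * 15367 * ((P.Klam * |U|) ^ 3 * ((2 : ℝ) ^ (n + 1))⁻¹)) ≤ Ebar)
    (hD : 0 ≤ D) :
    ‖a - d‖ ≤ gainBar klEngGeo14 P U (n + 1) (klTorusNorm L Qm) (klTorusNorm L (k - k')) (klTorusNorm L (k + k' - Qm)) + Ebar +
      thermalBar klEngGeo14 P U β (n + 1) + D + frameShiftBar P Q U (n + 1) := by
  have hTb := transferBarRelIdx_le_slots_klEngGeo14_of_cap (L := L) hKl hr hrc β U n Qm k k'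
  have hρ : 0 ≤ klTorusNorm L Qm := by unfold klTorusNorm; exact torusSupNorm_nonneg _
  have hρd : 0 ≤ klTorusNorm L (k - k') := by unfold klTorusNorm; exact torusSupNorm_nonneg _
  have hρx : 0 ≤ klTorusNorm L (k + k' - Qm) := by unfold klTorusNorm; exact torusSupNorm_nonneg _
  exact outClass_hout_le_bars_klEngGeo14_of_shares hρ hρd hρx hshift h₁ h₃ (by linarith) hE hD

/-! ## §3 The assembled bracket lifts along `G ≼ G′` -/

/-- **The out-of-class bracket is monotone in the package**: `gainBar` and `thermalBar` grow, the other three slots are `G`-free. -/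
theorem _root_.Summit.HubbardSuperconductivity.HubbardSuperconductivity.Theorems.KLRegimeSplit.GeoConsts.SlotLE.outClass_bound_le
    {G G' : GeoConsts} (h : GeoConsts.SlotLE G G') (P : SplitConsts) (Q : EngConsts) (U β : ℝ) (N : ℕ) (ρpp ρd ρx Ebar D : ℝ) :
    gainBar G P U N ρpp ρd ρx + Ebar + thermalBar G P U β N + D + frameShiftBar P Q U N ≤
      gainBar G' P U N ρpp ρd ρx + Ebar + thermalBar G' P U β N + D + frameShiftBar P Q U N := by
  have h1 := h.gainBar_mono P U N ρpp ρd ρx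
  have h2 := h.thermalBar_mono P U β N
  linarith

/-- **Lift of an assembled `hout` bound along `G ≼ G′`** (abstract erem host). -/
theorem _root_.Summit.HubbardSuperconductivity.HubbardSuperconductivity.Theorems.KLRegimeSplit.GeoConsts.SlotLE.outClass_hout_lift
    {G G' : GeoConsts} (h : GeoConsts.SlotLE G G') {P : SplitConsts} {Q : EngConsts} {U β : ℝ} {N : ℕ} {ρpp ρd ρx Ebar D x : ℝ}
    (hx : x ≤ gainBar G P U N ρpp ρd ρx + Ebar + thermalBar G P U β N + D + frameShiftBar P Q U N) :
    x ≤ gainBar G' P U N ρpp ρd ρx + Ebar + thermalBar G' P U β N + D + frameShiftBar P Q U N :=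
  hx.trans (h.outClass_bound_le P Q U β N ρpp ρd ρx Ebar D)

/-- **Lift of an assembled `hout` bound along `G ≼ G′`, erem LITERAL** (`eremBar G′ = eremBar G` along `SlotLE`). -/
theorem _root_.Summit.HubbardSuperconductivity.HubbardSuperconductivity.Theorems.KLRegimeSplit.GeoConsts.SlotLE.outClass_hout_lift_erem
    {G G' : GeoConsts} (h : GeoConsts.SlotLE G G') {P : SplitConsts} {Q : EngConsts} {U β : ℝ} {L n N : ℕ} {ρpp ρd ρx D x : ℝ}
    (hx : x ≤ gainBar G P U N ρpp ρd ρx + eremBar G P Q U β L n + thermalBar G P U β N + D + frameShiftBar P Q U N) :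
    x ≤ gainBar G' P U N ρpp ρd ρx + eremBar G' P Q U β L n + thermalBar G' P U β N + D + frameShiftBar P Q U N := by
  rw [h.eremBar_eq P Q U β L n]
  exact h.outClass_hout_lift hx

/-- **`hout` AT `klEngGeo14` FROM `hout` AT `klEngGeo13`** (erem literal): the conclusion of `outClass_hout_klEngGeo13(_alpha/_of_raw)` lifts by one call. -/
theorem outClass_hout_klEngGeo14_of_klEngGeo13 {P : SplitConsts} {Q : EngConsts} {U β : ℝ} {L n N : ℕ} {ρpp ρd ρx D x : ℝ}
    (hx : x ≤ gainBar klEngGeo13 P U N ρpp ρd ρx + eremBar klEngGeo13 P Q U β L n + thermalBar klEngGeo13 P U β N + D + frameShiftBar P Q U N) :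
    x ≤ gainBar klEngGeo14 P U N ρpp ρd ρx + eremBar klEngGeo14 P Q U β L n + thermalBar klEngGeo14 P U β N + D + frameShiftBar P Q U N :=
  slotLE_klEngGeo13_klEngGeo14.outClass_hout_lift_erem hx

/-- **`hout` AT `klEngGeo14` FROM `hout` AT `klEngGeo13`**, abstract erem host. -/
theorem outClass_hout_klEngGeo14_of_klEngGeo13_host {P : SplitConsts} {Q : EngConsts} {U β : ℝ} {N : ℕ} {ρpp ρd ρx Ebar D x : ℝ}
    (hx : x ≤ gainBar klEngGeo13 P U N ρpp ρd ρx + Ebar + thermalBar klEngGeo13 P U β N + D + frameShiftBar P Q U N) :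
    x ≤ gainBar klEngGeo14 P U N ρpp ρd ρx + Ebar + thermalBar klEngGeo14 P U β N + D + frameShiftBar P Q U N :=
  slotLE_klEngGeo13_klEngGeo14.outClass_hout_lift hx

/-- `eremBar klEngGeo14 = eremBar klEngGeo11` (the erem slot does not read gains or `CF`). -/
theorem eremBar_klEngGeo14_eq (P : SplitConsts) (Q : EngConsts) (U β : ℝ) (L n : ℕ) :
    eremBar klEngGeo14 P Q U β L n = eremBar klEngGeo11 P Q U β L n := by
  rw [slotLE_klEngGeo13_klEngGeo14.eremBar_eq, eremBar_klEngGeo13_eq]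

/-! ## §4 The erem share arithmetic with the flat cubic -/

/-- **The capped bar's residue WITH THE FLAT CUBIC at a share, flat passing through**: for `0 ≤ a`, `0 ≤ G.cloc`, `0 ≤ Klam`, any `r`, `c₃` with
`2r·15367 ≤ a·Q.CR`, `2r·15367·(KlamU)² ≤ a·Q.CL β n`:
`2r·15367(KlamU)²/L + 4r·15367(Klam|U|)³2^{−(n+1)} + 2r·15367·(c₃(Klam|U|)³) ≤ a·eremBar G P Q U β L n + 2r·15367·(c₃(Klam|U|)³)`. -/
theorem relBarE2_flat_le_share (G : GeoConsts) (hcloc : 0 ≤ G.cloc) {P : SplitConsts} (hKl : 0 ≤ P.Klam) (Q : EngConsts) {U β a r : ℝ} (c₃ : ℝ)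
    (ha : 0 ≤ a) (L n : ℕ) (hCR : 2 * r * 15367 ≤ a * Q.CR) (hCL : 2 * r * 15367 * (P.Klam * U) ^ 2 ≤ a * Q.CL β n) :
    2 * r * 15367 * ((P.Klam * U) ^ 2 * ((L : ℝ))⁻¹) + 4 * r * 15367 * ((P.Klam * |U|) ^ 3 * ((2 : ℝ) ^ (n + 1))⁻¹) +
        2 * r * 15367 * (c₃ * (P.Klam * |U|) ^ 3) ≤
      a * eremBar G P Q U β L n + 2 * r * 15367 * (c₃ * (P.Klam * |U|) ^ 3) := by
  unfold eremBar
  have hL : (0 : ℝ) ≤ ((L : ℝ))⁻¹ := by positivity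
  have h2 : 0 < ((2 : ℝ) ^ n)⁻¹ := by positivity
  have hsucc : ((2 : ℝ) ^ (n + 1))⁻¹ = 2⁻¹ * ((2 : ℝ) ^ n)⁻¹ := by rw [pow_succ, mul_inv, mul_comm]
  have hU3 : 0 ≤ (P.Klam * |U|) ^ 3 := by have := mul_nonneg hKl (abs_nonneg U); positivity
  have h4 : 0 < (4 : ℝ) ^ (-(G.θ * n)) := Real.rpow_pos_of_pos (by norm_num) _
  have hα : 0 ≤ a * (G.cloc * (P.Klam * U) ^ 2 * (4 : ℝ) ^ (-(G.θ * n))) := by positivity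
  have hγ : 2 * r * 15367 * ((P.Klam * U) ^ 2 * ((L : ℝ))⁻¹) ≤ a * (Q.CL β n / L) := by
    rw [div_eq_mul_inv, ← mul_assoc, ← mul_assoc]
    exact mul_le_mul_of_nonneg_right (by linarith) hL
  have hβ : 4 * r * 15367 * ((P.Klam * |U|) ^ 3 * ((2 : ℝ) ^ (n + 1))⁻¹) ≤ a * (Q.CR * (P.Klam * |U|) ^ 3 * ((2 : ℝ) ^ n)⁻¹) := by
    rw [hsucc]
    have e : 4 * r * 15367 * ((P.Klam * |U|) ^ 3 * (2⁻¹ * ((2 : ℝ) ^ n)⁻¹)) = (2 * r * 15367) * ((P.Klam * |U|) ^ 3 * ((2 : ℝ) ^ n)⁻¹) := by ring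
    rw [e, show a * (Q.CR * (P.Klam * |U|) ^ 3 * ((2 : ℝ) ^ n)⁻¹) = (a * Q.CR) * ((P.Klam * |U|) ^ 3 * ((2 : ℝ) ^ n)⁻¹) by ring]
    exact mul_le_mul_of_nonneg_right hCR (mul_nonneg hU3 h2.le)
  nlinarith [hγ, hβ, hα]

/-- **The capped bar's residue WITH THE FLAT CUBIC, additive erem host**: under the same shares and `0 ≤ c₃`,
`E₂ + 2r·15367·(c₃(Klam|U|)³) ≤ a·(eremBar G P Q U β L n + Q.CR·(c₃·(Klam|U|)³))` — door (ii)'s host written additively (= the re-profiled `eremBar` of (D4) by `ring`). -/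
theorem relBarE2_flat_le_share_host (G : GeoConsts) (hcloc : 0 ≤ G.cloc) {P : SplitConsts} (hKl : 0 ≤ P.Klam) (Q : EngConsts) {U β a r c₃ : ℝ}
    (ha : 0 ≤ a) (hc₃ : 0 ≤ c₃) (L n : ℕ) (hCR : 2 * r * 15367 ≤ a * Q.CR) (hCL : 2 * r * 15367 * (P.Klam * U) ^ 2 ≤ a * Q.CL β n) :
    2 * r * 15367 * ((P.Klam * U) ^ 2 * ((L : ℝ))⁻¹) + 4 * r * 15367 * ((P.Klam * |U|) ^ 3 * ((2 : ℝ) ^ (n + 1))⁻¹) +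
        2 * r * 15367 * (c₃ * (P.Klam * |U|) ^ 3) ≤
      a * (eremBar G P Q U β L n + Q.CR * (c₃ * (P.Klam * |U|) ^ 3)) := by
  have h := relBarE2_flat_le_share G hcloc hKl Q c₃ ha L n hCR hCL
  have hU3 : 0 ≤ c₃ * (P.Klam * |U|) ^ 3 := by have := mul_nonneg hKl (abs_nonneg U); positivity
  have hflat : 2 * r * 15367 * (c₃ * (P.Klam * |U|) ^ 3) ≤ a * (Q.CR * (c₃ * (P.Klam * |U|) ^ 3)) := by
    rw [show a * (Q.CR * (c₃ * (P.Klam * |U|) ^ 3)) = (a * Q.CR) * (c₃ * (P.Klam * |U|) ^ 3) by ring]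
    exact mul_le_mul_of_nonneg_right hCR hU3
  linarith

/-- **The `hE` binder from the shares** (erem literal): step (i)'s residue `E₁ = 2s·erem`, the bar's residue `E₂ ≤ a·erem`, `2s + a ≤ 1`, `0 ≤ erem` ⇒ `E₁ + E₂ ≤ erem`. -/
theorem hout_hE_of_share {s a erem E₂ : ℝ} (herem : 0 ≤ erem) (hsa : 2 * s + a ≤ 1) (hE₂ : E₂ ≤ a * erem) :
    2 * s * erem + E₂ ≤ erem := by nlinarith

/-- **The `hE` binder from the shares, additive host**: `E₂′ ≤ a·(erem + F)`, `2s + a ≤ 1`, `0 ≤ erem`, `0 ≤ F` ⇒ `2s·erem + E₂′ ≤ erem + F` (`Ē := erem + F`). -/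
theorem hout_hE_of_share_host {s a erem F E₂ : ℝ} (herem : 0 ≤ erem) (hF : 0 ≤ F) (hs : 0 ≤ s) (hsa : 2 * s + a ≤ 1) (hE₂ : E₂ ≤ a * (erem + F)) :
    2 * s * erem + E₂ ≤ erem + F := by nlinarith

/-- **BOTH SHARE HYPOTHESES AT `a = ½` FROM A `klTS`-KEYED `Q`-FLOOR** (the Q-side line of (R257)): for `0 ≤ r ≤ 2²⁰(1+klTS)`, `(KlamU)² ≤ 1`,
`2⁶⁰·Psq²·Rsq²·(1+klTS) ≤ Q.CR` and `2⁶⁰·Psq²·Rsq²·(1+klTS)·(β²+1)·4ⁿ ≤ Q.CL β n`: `2r·15367 ≤ ½·Q.CR` and `2r·15367·(KlamU)² ≤ ½·Q.CL β n`. -/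
theorem relBar_cap_shares_half_of_floor (P : SplitConsts) (R : RenConsts) (Q : EngConsts) {U β r : ℝ} (n : ℕ) (hr : 0 ≤ r) (hrc : r ≤ 2 ^ 20 * (1 + klTS))
    (hKU : (P.Klam * U) ^ 2 ≤ 1) (hQCR : 2 ^ 60 * klEngPsq P ^ 2 * klEngRsq R ^ 2 * (1 + klTS) ≤ Q.CR)
    (hQCL : 2 ^ 60 * klEngPsq P ^ 2 * klEngRsq R ^ 2 * (1 + klTS) * (β ^ 2 + 1) * (4 : ℝ) ^ n ≤ Q.CL β n) :
    2 * r * 15367 ≤ 2⁻¹ * Q.CR ∧ 2 * r * 15367 * (P.Klam * U) ^ 2 ≤ 2⁻¹ * Q.CL β n := by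
  have hT := klTS_nonneg
  have hP := one_le_klEngPsq P
  have hR := one_le_klEngRsq R
  have hPR : 1 ≤ klEngPsq P ^ 2 * klEngRsq R ^ 2 := by nlinarith [one_le_pow₀ (n := 2) hP, one_le_pow₀ (n := 2) hR]
  have h60 : (2 : ℝ) ^ 60 * (1 + klTS) ≤ Q.CR := by nlinarith
  have hb : (1 : ℝ) ≤ (β ^ 2 + 1) * (4 : ℝ) ^ n := by nlinarith [sq_nonneg β, one_le_pow₀ (n := n) (by norm_num : (1 : ℝ) ≤ 4)]
  have h60' : (2 : ℝ) ^ 60 * (1 + klTS) ≤ Q.CL β n := by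
    have : (2 : ℝ) ^ 60 * klEngPsq P ^ 2 * klEngRsq R ^ 2 * (1 + klTS) ≤ 2 ^ 60 * klEngPsq P ^ 2 * klEngRsq R ^ 2 * (1 + klTS) * ((β ^ 2 + 1) * (4 : ℝ) ^ n) :=
      le_mul_of_one_le_right (by positivity) hb
    nlinarith
  have hK0 : 0 ≤ (P.Klam * U) ^ 2 := sq_nonneg _
  have hr' : 2 * r * 15367 ≤ 2 ^ 35 * (1 + klTS) := by nlinarith
  constructor
  · nlinarith
  · nlinarith [mul_le_mul hr' hKU hK0 (by positivity)]

end Summit.HubbardSuperconductivity.HubbardSuperconductivity.Theorems.EngineV8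

end
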